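import Summits.CriticalPhenomena.PercolationContinuityZ3.Theorems.Transplant.SkelFrmFromBParamsBridgeF
import Summits.CriticalPhenomena.PercolationContinuityZ3.Theorems.Transplant.SkelFrmBParamsBridgeF
import Summits.CriticalPhenomena.PercolationContinuityZ3.Theorems.Transplant.PlanarSkeletonFrmFromDefs
import Summits.CriticalPhenomena.PercolationContinuityZ3.Theorems.Transplant.PlanarSkeletonFrmDefs
import Summits.CriticalPhenomena.PercolationContinuityZ3.Theorems.Transplant.SkelPhiStepIDataNS
import HarnessLib
import Summits.CriticalPhenomena.PercolationContinuityZ3.Theorems.Transplant.SkelFrmBParamsClearF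
/-!
# U-WAVE PORT (RULING D-U, lead g21 2026-08-26; WAVE-U-MANIFEST v3.1 row «SkelFrmBParamsClearF» ↦ «SkelFrmFromBParamsClearF») of the tree module
# `Transplant/SkelFrmBParamsClearF` onto the carrier `PlanarSkeletonFrmFrom` (frames only, cylinders connected from width `ℓ₀` on)

ORIGINAL TITLE: (F) VALUE LAYER, N2 twin (hp-8 g42, 2026-08-23; F-DISCHARGE-MAP-N2 G8/(Δ3)): `port_frm.py` text of N1 `SkelNegBParamsClearF` (stmt-g16) over the N2 wide bridge pair

builds on p205010 (kernel theorem, internal audit signed; external expert review pending) — nothing in this file uses p205010; NOTHING is claimed about the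
OPEN node U `SamePDropOfSkeletonFrmFrom₁` (nor U_s / the end state).  Lane `prim-bschramm`, seat `prim-bschramm-stmt` gen 26 (port pen, RULING M-11 family P-stmt; tool = p3-g26's port_u.py of record, registry-driven inputs); helper file
(`--supports stmt-CriticalPhenomena-4575 --as helper`).  PORT RULES r1–r4 of RULING D-U: declaration order and proof texts are those of the original,
byte-identical except (i) the carrier token `PlanarSkeletonFrm ↦ PlanarSkeletonFrmFrom` (binders, `namespace`/`end` lines, qualified names of twinned
declarations), (ii) carrier-FREE declarations of the original (φ-level `Skelφ…` blocks and namespace-only arithmetic residents) are NOT re-declared —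
this file imports the original and `export`s the twin-free residents (POLICY T / treatment (m1)); residents whose statement mentions a twinned
constant are copied, (iii) every carrier-binding declaration keeps its explicit binder `(Φ : PlanarSkeletonFrmFrom G)` in its own signature (r2).  Docstrings and citations are the original's.
-/

noncomputable section

open scoped Classical

namespace Summit.CriticalPhenomena.PercolationContinuityZ3.Theorems.Transplant

namespace PlanarSkeletonFrmFrom

namespace NegB

open Literature.Probability.Percolation Literature.Probability.LatticeModels SimpleGraph
open SkelConc (Consts)
open Skelφ.StepI (DataN)
open Neg

namespace KS

section ClearF

/-- The recession of `N + 1 ≤ c` regions at `R′ ≤ RA′` per region is `≤ c·RA′`. [folklore] -/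
theorem recession_le (κ : Consts) {V : Type} [DecidableEq V] [Countable V] {G : SimpleGraph V} [G.LocallyFinite] (Φ : PlanarSkeletonFrmFrom G) (t : V) (p : unitInterval) (D : Skelφ.StepI.DataNS V) (c : ℕ) (mk : ℕ) {N : ℕ} {R's : ℕ} (hc : N + 1 ≤ c) (hR : R's ≤ KS0.R'0 κ Φ t p D mk) : ((N : ℤ) + 1) * (R's : ℤ) ≤ (c : ℤ) * (KS0.R'0 κ Φ t p D mk : ℤ) := by
  have h : (N + 1) * R's ≤ c * KS0.R'0 κ Φ t p D mk := Nat.mul_le_mul hc hR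
  have h' : (((N + 1) * R's : ℕ) : ℤ) ≤ ((c * KS0.R'0 κ Φ t p D mk : ℕ) : ℤ) := by exact_mod_cast h
  push_cast at h'
  linarith

/-- **The α-floor, case same** (`c_lo := n_L + nBF − RA′` = core 1's frame-α start, `mem_core1F_same_iff`): `M_u + n_L + (N+1)·R′ < c_lo` for
`N + 1 ≤ c`, `R′ ≤ RA′` — any `n_L`. [folklore] -/
theorem clearF_s (κ : Consts) {V : Type} [DecidableEq V] [Countable V] {G : SimpleGraph V} [G.LocallyFinite] (Φ : PlanarSkeletonFrmFrom G) (t : V) (p : unitInterval) (D : Skelφ.StepI.DataNS V) (c : ℕ) (mk : ℕ) {N : ℕ} {R's : ℕ} (nL : ℕ) (hc : N + 1 ≤ c) (hR : R's ≤ KS0.R'0 κ Φ t p D mk) :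
    ((Mu D : ℕ) : ℤ) + nL + ((N : ℤ) + 1) * (R's : ℤ) < (nL : ℤ) + nBF κ Φ t p D c mk - KS0.R'0 κ Φ t p D mk := by
  have h1 := clearF κ Φ t p D c mk
  have h2 := recession_le κ Φ t p D c mk hc hR
  have h3 : (0 : ℤ) ≤ (KS0.R'0 κ Φ t p D mk : ℤ) := by positivity
  nlinarith

/-- Steep transposed bridge: `2|hBF| > ℓBF ≥ 2·bF + 27` gives `|hBF| ≥ bF + 14 = M_u + (c+2)·RA′ + 15`. [folklore] -/
theorem abs_hBF_ge_of_side (κ : Consts) {V : Type} [DecidableEq V] [Countable V] {G : SimpleGraph V} [G.LocallyFinite] (Φ : PlanarSkeletonFrmFrom G) (t : V) (p : unitInterval) (D : Skelφ.StepI.DataNS V) (c : ℕ) (mk : ℕ) (hside : ℓBF κ Φ t p D c mk < 2 * (hBF κ Φ t p D c mk).natAbs) (hℓb : 2 * bF κ Φ t p D c mk + 27 ≤ ℓBF κ Φ t p D c mk) :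
    ((Mu D : ℕ) : ℤ) + ((c : ℤ) + 2) * (KS0.R'0 κ Φ t p D mk : ℤ) + 15 ≤ |hBF κ Φ t p D c mk| := by
  have hb := (bF_facts κ Φ t p D c mk).1
  have h1 : Mu D + (c + 2) * KS0.R'0 κ Φ t p D mk + 15 ≤ (hBF κ Φ t p D c mk).natAbs := by omega
  have h2 : ((Mu D + (c + 2) * KS0.R'0 κ Φ t p D mk + 15 : ℕ) : ℤ) ≤ (((hBF κ Φ t p D c mk).natAbs : ℕ) : ℤ) := by exact_mod_cast h1
  push_cast [Int.natCast_natAbs] at h2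
  exact h2

/-- **The α-floor, steep transposed case** (`c_lo := n_L − RA′ + |hBF|`, `mem_core1F_side_iff`): `M_u + n_L + (N+1)·R′ < c_lo` for `N + 1 ≤ c`,
`R′ ≤ RA′`, `2|hBF| > ℓBF`, `2·bF + 27 ≤ ℓBF` (`ℓBF_ge`). [folklore] -/
theorem clearF_d (κ : Consts) {V : Type} [DecidableEq V] [Countable V] {G : SimpleGraph V} [G.LocallyFinite] (Φ : PlanarSkeletonFrmFrom G) (t : V) (p : unitInterval) (D : Skelφ.StepI.DataNS V) (c : ℕ) (mk : ℕ) {N : ℕ} {R's : ℕ} (nL : ℕ) (hc : N + 1 ≤ c) (hR : R's ≤ KS0.R'0 κ Φ t p D mk) (hside : ℓBF κ Φ t p D c mk < 2 * (hBF κ Φ t p D c mk).natAbs)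
    (hℓb : 2 * bF κ Φ t p D c mk + 27 ≤ ℓBF κ Φ t p D c mk) :
    ((Mu D : ℕ) : ℤ) + nL + ((N : ℤ) + 1) * (R's : ℤ) < (nL : ℤ) - KS0.R'0 κ Φ t p D mk + |hBF κ Φ t p D c mk| := by
  have h1 := abs_hBF_ge_of_side κ Φ t p D c mk hside hℓb
  have h2 := recession_le κ Φ t p D c mk hc hR
  have h3 : (0 : ℤ) ≤ (KS0.R'0 κ Φ t p D mk : ℤ) := by positivity
  nlinarith

/-- Flat transposed bridge: `2|hBF| ≤ ℓBF`, `2·bF + 27 ≤ ℓBF` give `ℓBF − |hBF| − 11 ≥ bF + 2 = M_u + (c+2)·RA′ + 3`. [folklore] -/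
theorem sub_abs_hBF_ge_of_top (κ : Consts) {V : Type} [DecidableEq V] [Countable V] {G : SimpleGraph V} [G.LocallyFinite] (Φ : PlanarSkeletonFrmFrom G) (t : V) (p : unitInterval) (D : Skelφ.StepI.DataNS V) (c : ℕ) (mk : ℕ) (htop : 2 * (hBF κ Φ t p D c mk).natAbs ≤ ℓBF κ Φ t p D c mk) (hℓb : 2 * bF κ Φ t p D c mk + 27 ≤ ℓBF κ Φ t p D c mk) :
    ((Mu D : ℕ) : ℤ) + ((c : ℤ) + 2) * (KS0.R'0 κ Φ t p D mk : ℤ) + 3 ≤ (ℓBF κ Φ t p D c mk : ℤ) - |hBF κ Φ t p D c mk| - 11 := by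
  have hb := (bF_facts κ Φ t p D c mk).1
  have h1 : Mu D + (c + 2) * KS0.R'0 κ Φ t p D mk + 3 + (hBF κ Φ t p D c mk).natAbs + 11 ≤ ℓBF κ Φ t p D c mk := by omega
  have h2 : ((Mu D + (c + 2) * KS0.R'0 κ Φ t p D mk + 3 + (hBF κ Φ t p D c mk).natAbs + 11 : ℕ) : ℤ) ≤ (ℓBF κ Φ t p D c mk : ℤ) := by exact_mod_cast h1
  push_cast [Int.natCast_natAbs] at h2
  linarith

/-- **The α-floor, flat transposed case** (`c_lo := n_L − RA′ + ℓBF − |hBF| − 11`, `mem_core1F_top_iff`): `M_u + n_L + (N+1)·R′ < c_lo` for `N + 1 ≤ c`,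
`R′ ≤ RA′`, `2|hBF| ≤ ℓBF`, `2·bF + 27 ≤ ℓBF`. [folklore] -/
theorem clearF_t (κ : Consts) {V : Type} [DecidableEq V] [Countable V] {G : SimpleGraph V} [G.LocallyFinite] (Φ : PlanarSkeletonFrmFrom G) (t : V) (p : unitInterval) (D : Skelφ.StepI.DataNS V) (c : ℕ) (mk : ℕ) {N : ℕ} {R's : ℕ} (nL : ℕ) (hc : N + 1 ≤ c) (hR : R's ≤ KS0.R'0 κ Φ t p D mk) (htop : 2 * (hBF κ Φ t p D c mk).natAbs ≤ ℓBF κ Φ t p D c mk)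
    (hℓb : 2 * bF κ Φ t p D c mk + 27 ≤ ℓBF κ Φ t p D c mk) :
    ((Mu D : ℕ) : ℤ) + nL + ((N : ℤ) + 1) * (R's : ℤ) < (nL : ℤ) - KS0.R'0 κ Φ t p D mk + ((ℓBF κ Φ t p D c mk : ℤ) - |hBF κ Φ t p D c mk| - 11) := by
  have h1 := sub_abs_hBF_ge_of_top κ Φ t p D c mk htop hℓb
  have h2 := recession_le κ Φ t p D c mk hc hR
  have h3 : (0 : ℤ) ≤ (KS0.R'0 κ Φ t p D mk : ℤ) := by positivity
  nlinarith

end ClearF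

end KS

end NegB

end PlanarSkeletonFrmFrom

end Summit.CriticalPhenomena.PercolationContinuityZ3.Theorems.Transplant

end
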